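import Summits.NavierStokesRegularity.NavierStokesRegularity.Theses.QuantisedSymmetry
import Summits.NavierStokesRegularity.NavierStokesRegularity.Theses.Blowup
import Summits.NavierStokesRegularity.NavierStokesRegularity.Theses.DssFarFieldSlaving
import Summits.NavierStokesRegularity.NavierStokesRegularity.Theorems.QuantisedSymmetryPolyhedralTruncationBridge
import Summits.NavierStokesRegularity.NavierStokesRegularity.Theorems.QuantisedSymmetryLiouvilleKillsProfile
import Summits.NavierStokesRegularity.NavierStokesRegularity.Theorems.DssFarFieldSlavingDssTruncationBridge
import Summits.NavierStokesRegularity.NavierStokesRegularity.Theorems.QuantisedSymmetryPolyhedralDssProfileExistsDominatesBlowupProfile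
import Summits.NavierStokesRegularity.NavierStokesRegularity.Theorems.QuantisedSymmetryPolyhedralDssProfileExistsOfCell
import Summits.NavierStokesRegularity.NavierStokesRegularity.Theorems.QuantisedSymmetryPolyhedralDssProfileExistsCellOfProfile
import HarnessLib

/-!
# Strategist sketch S19-g21 (independent census, family `s`) — crux `PolyhedralDssProfileExists`
# (stmt-NavierStokesRegularity-1404, route `QuantisedSymmetry`, NEGATIVE side)

Typed companions of `STRATEGY-CENSUS-s19.md` (gen 21).  Nothing here is a registered stub; every
`theorem` is proved (no `sorry`).  Sections:

* §0 summit strength: `X → ¬ NavierStokesRegularity` is an in-tree chain (`closes` + the proved bridge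
  + the proved Clay uniqueness), and so is `W1 → ¬ NavierStokesRegularity` for the only strictly-weaker
  in-tree intermediate `W1 = Blowup.BlowupTypeIDssProfile` (stmt-0155).
* §1 the cell dictionary `X ↔ ∃ polyhedral cell` (landed `polyhedralDssProfileExists_iff_cell`).
* §2 STRENGTHEN: `S⁺ = TransversallyIsolatedCellExists` (a cell isolated modulo the residual scaling
  circle — what a Newton–Kantorovich certificate would output) and `S⁺ → X`.
* §3 DECOMPOSITION D-C: `ApproxCellExists δ` (a `δ`-approximate polyhedral cell with unit-size datum)
  and `ApproxCellShadowing δ` (every `δ`-approximate cell is shadowed by an exact cell within `1/2` in sup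
  norm at the datum), with the assembly `ApproxCellExists δ → ApproxCellShadowing δ → X` PROVED.
* §4 NEGATION: the kill switch `PolyhedralTypeILiouville → ¬ X` (landed) and its contrapositive.
-/

set_option linter.dupNamespace false
set_option linter.unusedVariables false

namespace Summit.NavierStokesRegularity.NavierStokesRegularity.Cruxes.PolyhedralDssProfileExists.StrategistS19g21

open MeasureTheory Set Function Filter Topology
open Literature.Analysis.FluidPDE

/-! ## §0 Names and summit strength -/

/-- The crux X⁻ of route `QuantisedSymmetry` (stmt-NavierStokesRegularity-1404). -/
abbrev X : Prop :=
  _root_.Summit.NavierStokesRegularity.NavierStokesRegularity.Theses.QuantisedSymmetry.PolyhedralDssProfileExists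

/-- W1: the sector-free intermediate `Blowup.BlowupTypeIDssProfile` (stmt-NavierStokesRegularity-0155),
the negation of Tsai's Type-I (rotated) DSS Liouville conjecture. -/
abbrev W1 : Prop :=
  _root_.Summit.NavierStokesRegularity.NavierStokesRegularity.Theses.Blowup.BlowupTypeIDssProfile

/-- Kill switch #3 of the route (stmt-NavierStokesRegularity-1405). -/
abbrev K3 : Prop :=
  _root_.Summit.NavierStokesRegularity.NavierStokesRegularity.Theses.QuantisedSymmetry.PolyhedralTypeILiouville

/-- **X alone decides the sub-problem (in tree).** `closes` with its two other hypotheses discharged by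
landed theorems: the per-profile truncation bridge (stmt-11331) and Clay uniqueness (stmt-0153). -/
theorem not_navierStokesRegularity_of_X (hX : X) : ¬ _root_.NavierStokesRegularity :=
  _root_.Summit.NavierStokesRegularity.NavierStokesRegularity.Theses.QuantisedSymmetry.closes hX
    _root_.Summit.NavierStokesRegularity.NavierStokesRegularity.Theorems.quantisedSymmetry_polyhedralTruncationBridge_proof
    _root_.Summit.NavierStokesRegularity.NavierStokesRegularity.Theses.QuantisedSymmetry.ClayUniqueness_holds

/-- **X implies the weaker intermediate W1** (landed `stub_dominatesBlowupProfile`, lead c15). -/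
theorem W1_of_X : X → W1 :=
  _root_.Summit.NavierStokesRegularity.NavierStokesRegularity.Theorems.PolyhedralDssProfileExists.PolyhedralCell.stub_dominatesBlowupProfile

/-- **W1 alone also decides the sub-problem (in tree)**: route `DssFarFieldSlaving`'s deciding theorem
with its bridge `DssTruncationBridge` (stmt-14477) proved. So the only strictly-weaker in-tree
replacement of X is itself summit-deciding and is already the shared open crux stmt-0155. -/
theorem not_navierStokesRegularity_of_W1 (h : W1) : ¬ _root_.NavierStokesRegularity :=
  _root_.Summit.NavierStokesRegularity.NavierStokesRegularity.Theses.DssFarFieldSlaving.closes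
    _root_.Summit.NavierStokesRegularity.NavierStokesRegularity.Theorems.dssTruncationBridge_proof h

/-! ## §1 The cell dictionary -/

/-- Finite irreducible rotation group (the group clauses of X). -/
def IsPolyhedralGroup (G : Subgroup (EuclideanSpace ℝ (Fin 3) ≃ₗᵢ[ℝ] EuclideanSpace ℝ (Fin 3))) : Prop :=
  Finite G ∧
    (∀ g ∈ G, LinearMap.det (g.toLinearEquiv : EuclideanSpace ℝ (Fin 3) →ₗ[ℝ] EuclideanSpace ℝ (Fin 3)) = 1) ∧
    (∀ V : Submodule ℝ (EuclideanSpace ℝ (Fin 3)), (∀ g ∈ G, ∀ v ∈ V, g v ∈ V) → V = ⊥ ∨ V = ⊤)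

/-- The dynamical clauses of a `G`-cell with factor `c` on the model period `[-1, -c⁻²]` (continuity,
boundedness, weak solenoidality, Oseen-mild between model times, zoom closure, slice-wise equivariance). -/
def IsCellDyn (G : Subgroup (EuclideanSpace ℝ (Fin 3) ≃ₗᵢ[ℝ] EuclideanSpace ℝ (Fin 3))) (c : ℝ)
    (v : ℝ → EuclideanSpace ℝ (Fin 3) → EuclideanSpace ℝ (Fin 3)) : Prop :=
  ContinuousOn (Function.uncurry v) (Set.Icc (-1 : ℝ) (-(c ^ 2)⁻¹) ×ˢ Set.univ) ∧
    (∃ M : ℝ, ∀ t ∈ Set.Icc (-1 : ℝ) (-(c ^ 2)⁻¹), ∀ x, ‖v t x‖ ≤ M) ∧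
    (∀ t ∈ Set.Icc (-1 : ℝ) (-(c ^ 2)⁻¹), IsWeaklyDivFree (v t)) ∧
    (∀ s t : ℝ, -1 ≤ s → s < t → t ≤ -(c ^ 2)⁻¹ → ∀ x,
      v t x = heatFlow (v s) (t - s) x - oseenDuhamel 1 s v v t x) ∧
    (∀ x, v (-(c ^ 2)⁻¹) x = c • v (-1) (c • x)) ∧
    (∀ g ∈ G, ∀ t ∈ Set.Icc (-1 : ℝ) (-(c ^ 2)⁻¹), ∀ x, v t (g x) = g (v t x))

/-- A (nontrivial, `L⁴`) `G`-cell with factor `c`: the body of the line's open stub. -/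
def IsCell (G : Subgroup (EuclideanSpace ℝ (Fin 3) ≃ₗᵢ[ℝ] EuclideanSpace ℝ (Fin 3))) (c : ℝ)
    (v : ℝ → EuclideanSpace ℝ (Fin 3) → EuclideanSpace ℝ (Fin 3)) : Prop :=
  IsCellDyn G c v ∧ MemLp (v (-1)) 4 volume ∧ ¬ (v (-1) =ᵐ[volume] 0)

/-- **X ↔ a polyhedral cell exists** (repackaging of the landed `polyhedralDssProfileExists_iff_cell`). -/
theorem X_iff_cell :
    X ↔ ∃ G, IsPolyhedralGroup G ∧ ∃ c : ℝ, 1 < c ∧ ∃ v, IsCell G c v := by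
  refine (_root_.Summit.NavierStokesRegularity.NavierStokesRegularity.Theorems.PolyhedralDssProfileExists.PolyhedralCell.polyhedralDssProfileExists_iff_cell).trans
    ⟨?_, ?_⟩
  · rintro ⟨G, hfin, hdet, hirr, c, hc, v, hdyn, hL4, hnt⟩
    exact ⟨G, ⟨hfin, hdet, hirr⟩, c, hc, v, hdyn, hL4, hnt⟩
  · rintro ⟨G, ⟨hfin, hdet, hirr⟩, c, hc, v, hdyn, hL4, hnt⟩
    exact ⟨G, hfin, hdet, hirr, c, hc, v, hdyn, hL4, hnt⟩

/-! ## §2 STRENGTHEN — `S⁺`: a transversally isolated cell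

Cells are never isolated outright: the residual scaling `u ↦ u_μ`, `1 ≤ μ < c`, of the concatenated
profile maps cells to cells (a circle, `u_c = u`), and in terms of the cell `v` alone the scaled datum is
`x ↦ (μ/c) · v(-(μ/c)², (μ/c) x)` (slab `k = 1` of the concatenation).  `S⁺` asks for a cell whose
sup-norm neighbourhood among cells with the same `(G, c)` is exactly this circle — the output of an
implicit-function / Newton–Kantorovich argument at a transversally nondegenerate fixed point of the
renormalisation map.  It implies X by forgetting the isolation; the census records why the added
rigidity gives no EXISTENCE mechanism (no parameter to continue in: `c → 1⁺` is empty under a fixed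
Type-I constant by `NearOneDssTypeIExclusion_holds`, `c → ∞` has no limiting theory, `ν` scales out). -/

/-- `S⁺`: a transversally isolated polyhedral cell exists. -/
def TransversallyIsolatedCellExists : Prop :=
  ∃ G, IsPolyhedralGroup G ∧ ∃ c : ℝ, 1 < c ∧ ∃ v, IsCell G c v ∧
    ∃ ε : ℝ, 0 < ε ∧ ∀ w, IsCell G c w → (∀ x, ‖w (-1) x - v (-1) x‖ < ε) →
      ∃ μ : ℝ, 1 ≤ μ ∧ μ < c ∧ ∀ x, w (-1) x = (μ / c) • v (-((μ / c) ^ 2)) ((μ / c) • x)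

/-- `S⁺ → X` (forget the isolation). -/
theorem X_of_transversallyIsolatedCell : TransversallyIsolatedCellExists → X := by
  rintro ⟨G, hG, c, hc, v, hv, -⟩
  exact X_iff_cell.mpr ⟨G, hG, c, hc, v, hv⟩

/-! ## §3 DECOMPOSITION D-C — approximate cell + shadowing

`X₁ δ = ApproxCellExists δ`: a `δ`-APPROXIMATE polyhedral cell (every clause of a cell exact except the
Oseen–Duhamel relation, which holds up to `δ` pointwise on the model period) whose datum has unit size
somewhere.  `X₂ δ = ApproxCellShadowing δ`: every such approximate cell is shadowed by an exact cell
with `L⁴` datum within `1/2` of it in sup norm at `t = -1`.  The assembly `X₁ δ → X₂ δ → X` is proved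
below (nontriviality: the exact datum is continuous and at distance `≤ 1/2` from a vector of norm `≥ 1`,
so it is not a.e. zero — `Continuous.ae_eq_iff_eq`).  The census records why the split has no plan:
`X₁ δ` is content-free for `δ ≳ M²` (group-averaged interpolants) and is the whole numerical-candidate
problem for small `δ` (no polyhedral near-cell is known; octahedral Kida–Pelz flows saturate), while
`X₂ δ` without a nondegeneracy certificate is a closing lemma for a non-hyperbolic non-compact map
(false as a blanket statement for large `δ` unless X holds outright), and WITH one it is a
radii-polynomial theorem whose finite input nobody can presently produce. -/

/-- A `δ`-approximate `G`-cell with factor `c`, sup bound `M` and unit-size `L⁴` datum. -/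
def IsApproxCell (G : Subgroup (EuclideanSpace ℝ (Fin 3) ≃ₗᵢ[ℝ] EuclideanSpace ℝ (Fin 3))) (c M δ : ℝ)
    (v : ℝ → EuclideanSpace ℝ (Fin 3) → EuclideanSpace ℝ (Fin 3)) : Prop :=
  ContinuousOn (Function.uncurry v) (Set.Icc (-1 : ℝ) (-(c ^ 2)⁻¹) ×ˢ Set.univ) ∧
    (∀ t ∈ Set.Icc (-1 : ℝ) (-(c ^ 2)⁻¹), ∀ x, ‖v t x‖ ≤ M) ∧
    (∀ t ∈ Set.Icc (-1 : ℝ) (-(c ^ 2)⁻¹), IsWeaklyDivFree (v t)) ∧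
    (∀ s t : ℝ, -1 ≤ s → s < t → t ≤ -(c ^ 2)⁻¹ → ∀ x,
      ‖v t x - (heatFlow (v s) (t - s) x - oseenDuhamel 1 s v v t x)‖ ≤ δ) ∧
    (∀ x, v (-(c ^ 2)⁻¹) x = c • v (-1) (c • x)) ∧
    (∀ g ∈ G, ∀ t ∈ Set.Icc (-1 : ℝ) (-(c ^ 2)⁻¹), ∀ x, v t (g x) = g (v t x)) ∧
    MemLp (v (-1)) 4 volume ∧ (∃ x, 1 ≤ ‖v (-1) x‖)

/-- `X₁ δ`: a `δ`-approximate polyhedral cell exists. -/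
def ApproxCellExists (δ : ℝ) : Prop :=
  ∃ G, IsPolyhedralGroup G ∧ ∃ c : ℝ, 1 < c ∧ ∃ M : ℝ, ∃ v, IsApproxCell G c M δ v

/-- `X₂ δ`: every `δ`-approximate polyhedral cell is shadowed by an exact cell (same `G`, same `c`) with
`L⁴` datum, within `1/2` of it in sup norm at the datum time. -/
def ApproxCellShadowing (δ : ℝ) : Prop :=
  ∀ G, IsPolyhedralGroup G → ∀ c : ℝ, 1 < c → ∀ (M : ℝ) (v : ℝ → EuclideanSpace ℝ (Fin 3) → EuclideanSpace ℝ (Fin 3)),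
    IsApproxCell G c M δ v →
      ∃ w : ℝ → EuclideanSpace ℝ (Fin 3) → EuclideanSpace ℝ (Fin 3),
        IsCellDyn G c w ∧ MemLp (w (-1)) 4 volume ∧ ∀ x, ‖w (-1) x - v (-1) x‖ ≤ 1 / 2

/-- The datum of a cell is continuous (restriction of the jointly continuous field to `t = -1`). -/
theorem continuous_datum_of_cellDyn {G : Subgroup (EuclideanSpace ℝ (Fin 3) ≃ₗᵢ[ℝ] EuclideanSpace ℝ (Fin 3))}
    {c : ℝ} (hc : 1 < c) {w : ℝ → EuclideanSpace ℝ (Fin 3) → EuclideanSpace ℝ (Fin 3)}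
    (hw : IsCellDyn G c w) : Continuous (w (-1)) := by
  obtain ⟨hcont, -⟩ := hw
  have hc2 : (1 : ℝ) ≤ c ^ 2 := by nlinarith
  have hinv : (c ^ 2)⁻¹ ≤ 1 := inv_le_one_of_one_le₀ hc2
  have hmem : ∀ x : EuclideanSpace ℝ (Fin 3),
      ((-1 : ℝ), x) ∈ Set.Icc (-1 : ℝ) (-(c ^ 2)⁻¹) ×ˢ (Set.univ : Set (EuclideanSpace ℝ (Fin 3))) :=
    fun x => ⟨⟨le_rfl, by linarith⟩, Set.mem_univ _⟩
  have h := hcont.comp_continuous (continuous_const.prodMk continuous_id) hmem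
  exact h

/-- **Assembly of D-C (proved):** `X₁ δ → X₂ δ → X`. -/
theorem X_of_approxCell (δ : ℝ) : ApproxCellExists δ → ApproxCellShadowing δ → X := by
  rintro ⟨G, hG, c, hc, M, v, hv⟩ hshadow
  obtain ⟨w, hdyn, hL4, hclose⟩ := hshadow G hG c hc M v hv
  obtain ⟨x₀, hx₀⟩ := hv.2.2.2.2.2.2.2
  refine X_iff_cell.mpr ⟨G, hG, c, hc, w, hdyn, hL4, ?_⟩
  intro hae
  have hcontw : Continuous (w (-1)) := continuous_datum_of_cellDyn hc hdyn
  have hzero : w (-1) = fun _ => 0 :=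
    (Continuous.ae_eq_iff_eq volume hcontw continuous_const).1 hae
  have h1 : ‖w (-1) x₀ - v (-1) x₀‖ ≤ 1 / 2 := hclose x₀
  rw [hzero] at h1
  simp only [zero_sub, norm_neg] at h1
  linarith

/-- Per-piece probe record: `X₂ δ` is consumed only together with `X₁ δ`; neither piece is X reworded —
`X₁` speaks of approximate (non-NS) objects, `X₂` is a closing statement.  (That `X₂ δ ∧ X₁ δ` for a
trivially satisfiable `X₁ δ` collapses to X is the census's objection, not a Lean fact recorded here.) -/
theorem X_of_approxCell' : (∃ δ : ℝ, ApproxCellExists δ ∧ ApproxCellShadowing δ) → X := by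
  rintro ⟨δ, h₁, h₂⟩
  exact X_of_approxCell δ h₁ h₂

/-! ## §4 NEGATION — the kill switch is the only typed obstruction -/

/-- `K3 → ¬ X` (landed `quantisedSymmetry_liouvilleKillsProfile_proof`, stmt-1408). -/
theorem not_X_of_K3 : K3 → ¬ X :=
  _root_.Summit.NavierStokesRegularity.NavierStokesRegularity.Theorems.quantisedSymmetry_liouvilleKillsProfile_proof

/-- Contrapositive: a witness of X refutes the polyhedral Type-I Liouville statement. -/
theorem not_K3_of_X (hX : X) : ¬ K3 := fun hK => not_X_of_K3 hK hX

end Summit.NavierStokesRegularity.NavierStokesRegularity.Cruxes.PolyhedralDssProfileExists.StrategistS19g21
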